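import Literature.MathematicalPhysics.QuantumFieldTheory.Balaban1983to89.B2Ineq2109HiggsLattice
import Literature.MathematicalPhysics.QuantumFieldTheory.Balaban1983to89.B2Eq2108ErrorBound
import Literature.MathematicalPhysics.QuantumFieldTheory.Balaban1983to89.B2Sect3AStatements

/-!
# `Balaban1983to89.B2Eq2108ErrorHiggsLattice` — [Balaban1982Higgs2] **(2.108)** p. 580, the ERROR TERM
# `O(1)e^{−δ₁r(Lᵏε)}·t²·|Λ₃^{(k)}| ≤ O((Lᵏε)^κ)|Λ₃^{(k)}|` of `½⟨Λ₆^{(k−1)′}φ, H_kΛ₆^{(k−1)′}φ⟩` under `|φ| ≤ t`, for the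
# CONCRETE `H_k` of `B2Ineq2109HiggsLattice` ON THE (Higgs)₂,₃ CARRIER OF RECORD (`HiggsLattice` tori, `Δ^{(k),Lᵏε}(Ω,B̃) =
# deltaKA` at a regular `B̃`), by `x`-dependent damping from r14's general-weight (I.2.29) + the volume-uniform TORUS sums

statement-level skeleton of published theorems with citation tags; proofs where landed; nothing here is a claim about the Yang–Mills mass gap

PDF held: `paper:balaban1982-cmp86-higgs23-ii` (T. Bałaban, *(Higgs)₂,₃ quantum fields in a finite volume. II. An upper
bound*, Commun. Math. Phys. **86** (1982) 555–594 [Balaban1982Higgs2]; journal page = PDF page + 554); p. 580 [PDF 26] READ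
AS AN IMAGE on `run/shared/lean/pub/pub-balaban/b2b-balaban-ref1/pages/1982-cmp86-higgs23-II/1982-cmp86-higgs23-II-p026-x2.png`
(also p. 558 [PDF 4] for (2.7)–(2.8), p. 570 [PDF 16] render `…-p016-x2.png` for (2.55); v1.1 (this seat's gen 17): the p. 580 quotation
below re-keyed sentence by sentence on the render — docstring-only change, every declaration byte-identical).

CITATION HEADER (lean-in-tree rule).  Cell `lit-balaban` (HOME `run/shared/lean/pub/lit-balaban/`), Phase-2 proof seat **p23**
gen 15 (unit `lit-balaban-p23-g15`); SKELETON row **B2.Eq2.109** ((2.108)–(2.109) p. 580; fold owner r02, second reader r14,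
referee ref-4); companion of `B2Ineq2109HiggsLattice` (this gen: `Inst`, `Adm`, `Hk`, the block lemmas `hk_PP/…/hk_33`, the
weights `w2`, the constants `gam/c227/c229`) and carrier port of this seat's gen-7 `B2Eq2108ErrorBound` (b04 carrier; its
elementary `printedThreshold_le` is REUSED by name).  USED BY NAME, files untouched: r14 g14
`B1Prop23RegularRegion.ineq227_regular_region_uniform`, `B1Ineq229RegularRegion.ineq229_regular_region` (general weight); typer
`B2Eq230CondShiftBound.sum_exp_neg_tdist_le` (`Σ_{y∈T^{(k)}} e^{−δ|x−y|} ≤ K_d(δ)` = `B4Sect5Proof.latticeConst`, volume-uniform);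
`B1Ineq234LevelZero.tdist_comm`; r14 `B2StepK.rDecayBeatsPowers_of_printed`.

WHAT IS PRINTED (p. 580 [PDF 26]; the printed sentences, quoted from the render).  Before (2.108): *"We will localize this
form in the set Λ₆^{(k−1)′}∩Λ₃^{(k)c}, Λ₃^{(k)}, and we will change the operators of the forms using Proposition I.2.2 and the
restrictions on the fields ψ, φ. We have"* — display (2.108), whose last line is *"+ O((Lᵏε)^κ)|Λ₃^{(k)}|."*  After (2.108): *"More
exactly the difference between the quadratic forms is a quadratic form ½⟨Λ₆^{(k−1)′}φ, H_kΛ₆^{(k−1)′}φ⟩ and for the matrix elements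
h_k(x, x′) of the operator H_k of this form, the following inequality holds |h_k(x, x′)| ≤ O(1)exp(−δ₁r(Lᵏε))exp(−δ₀|x − x′|)
≤ O((Lᵏε)^κ)exp(−δ₀|x − x′|) (2.109) for x, x′ ∈ Λ₆^{(k−1)′} and arbitrary κ."*  READING (ours, not a printed sentence): the
kernel bound (2.109), for `κ` arbitrarily large but fixed, summed against the restricted field `φ` is what produces the last term of
(2.108).  The restriction used: *"|φ(x)| ≤ c₁λ(L^{k−1}ε)^{−1/4}p(L^{k−1}ε) for x ∈ Λ₋₁^{(k−1)′}"* — the characteristic functions `χ_k`,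
(2.55) p. 570 [PDF 16] (`Λ₆^{(k−1)′} ⊂ Λ₋₁^{(k−1)′}`); `p(ε) = b₀(1 + log ε⁻¹)^p` (p. 557), `r(ε) = R(1 + log ε⁻¹)^r` (2.7).

WHY THE VOLUME IS `|Λ₃^{(k)}|`.  Summing the uniform kernel bound (2.109) over `x, x′ ∈ Λ₆^{(k−1)′}` gives `O((Lᵏε)^κ)|Λ₆^{(k−1)′}|`,
not the printed `|Λ₃^{(k)}|`.  The printed volume comes from WHERE `h_k` lives: by the block structure of `H_k`, `h_k(x,x′)`
vanishes unless `x` or `x′` lies in `Λ₄^{(k)} ⊂ Λ₃^{(k)}` or the entry is a `Δ(Ω) − Δ(Ω₁)` difference, and r14's (I.2.29) WITH A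
GENERAL WEIGHT damps that difference by `e^{−(δ/2)dist(x, Λ₅^{(k)})}` (`Λ₅ ⊂ Λ₃`, the defect of the pair `Ω₁ ⊆ Ω`) — an
`x`-DEPENDENT factor whose torus sum is `O(1)|Λ₅|`.

WHAT IS KERNEL-CHECKED (zero `sorry`, no new `def … : Prop`; axioms standard).
 §1 `d5` (distance to `Λ₅^{(k)}`), `w5` (the admissible `x`-dependent weight), `G5 i c x = Σ_{u∈Λ₅}e^{−c|x−u|}`, `W` (the profile:
    `G5` off `Λ₄`, indicators of `Λ₃`-rows/columns), **`Inst.abs_hk_le_W`**: `|h_k(p,q)| ≤ (c₀^{(2.27)} + c₀^{(2.29)})(Lᵏε)⁻²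
    e^{−(δ/2)r}e^{−(δ/2)|x−x′|}·W(x,x′)` for every `δ ≥ 0` with `(4d + 4a)δ ≤ γ₀`.
 §2 the torus sums (typer's `sum_exp_neg_tdist_le`): `sum_G5_le` (`Σ_x G5 ≤ |Λ₅|K_d`), **`sum_W_le`**:
    `Σ_{x,x′∈Λ₆′}e^{−(δ/2)|x−x′|}W(x,x′) ≤ K_d(δ/2)(K_d(δ/4) + 2)|Λ₃^{(k)}|` (`|Λ₅| ≤ |Λ₃|`).
 §3 **`Inst.abs_form_hk_le`**: `|⟨φ, H_kφ⟩| ≤ (c₀^{(2.27)}+c₀^{(2.29)})·N²·K_d(δ/2)(K_d(δ/4)+2)·(Lᵏε)⁻²·t²·e^{−(δ/2)r}·|Λ₃^{(k)}|` for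
    every admissible step and every `φ` on `Λ₆′×{1..N}` with `|φ| ≤ t`; **`abs_form_hk_le_explicit`** (printed quantifier shape:
    `∀ d, L > 1, a > 0 ∃ C, δ₁ > 0` before everything else); **`abs_form_hk_le_pow`**: with `r = r(Lᵏε)` in the printed ranges,
    `0 < Lᵏε ≤ 1`, `t ≤ T(Lᵏε)^{−m}`, for every `κ` a `C′` with `|⟨φ, (Lᵏε)²H_kφ⟩| ≤ C′(Lᵏε)^κ|Λ₃^{(k)}|`;
    **`abs_form_hk_le_printed`**: the same directly under `|φ| ≤ c₁λ(L^{k−1}ε)^{−1/4}p(L^{k−1}ε)` (gen 7's `printedThreshold_le`).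
 §4 **`ineq38_higgsLattice`**: r02's typed (3.8) p. 584 (`B2Sect3AStatements.Ineq38`, by r02's definition literally `Ineq2109` read at
    the chapter-3 step) INHABITED for the same carrier family (the companion's `ineq2109_higgsLattice`).

HONEST SCOPE.  (a) As in the companion: `H_k` is the carrier's concrete operator at a REGULAR `B̃` below r14's coupling threshold,
the sets and their (2.8) separations are hypotheses (`Inst`, `Adm`), `D2` carries `B̃` (domain reading of (2.93)).  (b) The field
restriction is a pointwise threshold `|φ(x)| ≤ t` on `Λ₆′ × {1..N}` (coordinates); §3 takes `t ≤ T(Lᵏε)^{−m}` resp. the printed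
`c₁λ(L^{k−1}ε)^{−1/4}p(L^{k−1}ε)` (`c₁λ` one nonnegative parameter); the `ψ`-restriction plays no role for the `H_k` term.
(c) `|Λ₃^{(k)}|` = the number of `k`-sites in `Λ₃^{(k)}` (the unit-lattice volume of print); the form bound is stated for `H_k` in
`Lᵏε`-units (factor `(Lᵏε)⁻²`) and, in §3's `O((Lᵏε)^κ)` versions, for the unit-lattice form `(Lᵏε)²⟨φ,H_kφ⟩` ((I.2.22)).
(d) Constants explicit, crude.  (e) Value = the printed error term of (2.108) on the carrier of record from (I.2.27)/(I.2.29) +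
(2.8); NOT summit progress.
-/

noncomputable section

open scoped BigOperators Matrix

namespace Literature.MathematicalPhysics.QuantumFieldTheory.Balaban1983to89.B2Eq2108ErrorHiggsLattice

open HiggsLattice HiggsAveraging HiggsCovariance B1Eq230FluctCov
open B1Prop23RegularRegion (ineq227_regular_region_uniform)
open B1Ineq229RegularRegion (ineq229_regular_region)
open B1Ineq234LevelZero (tdist_comm)
open B2Ineq2109HiggsLattice
open B2Ineq2109HiggsLattice.Inst (hk_PP hk_P34 hk_P4 hk_34P hk_4P hk_33 w2_adm w2_eq)
open Matrix

variable {P : HiggsLattice.Params} {N : ℕ}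

/-! ## §1 The `x`-dependent profile and the refined kernel bound -/

variable (i : Inst P N)

/-- `dist(y, Λ₅^{(k)})` (torus distance (I.1.3) to the set; `0` if `Λ₅ = ∅`). [cite: Balaban1982Higgs2, (2.8) p.558] -/
def d5 (y : HiggsLattice.Site P (i.j + 1)) : ℝ :=
  if h : i.L5.Nonempty then i.L5.inf' h (fun u => (HiggsLattice.Site.tdist y u : ℝ)) else 0

/-- the `x`-dependent weight of the pair `Ω₁ ⊆ Ω`: `dist(y, Λ₅)` on `Λ₆′ ∖ Λ₄`, `0` elsewhere. [cite: Balaban1982Higgs2, (2.8) p.558] -/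
def w5 : HiggsLattice.Site P (i.j + 1) → ℝ := fun y => if y ∈ i.L6 ∧ y ∉ i.L4 then d5 i y else 0

/-- `G5(x) = Σ_{u∈Λ₅^{(k)}} e^{−c|x − u|}` (majorant of `e^{−c·dist(x,Λ₅)}`, summable in `x`). [cite: Balaban1982Higgs2, (2.108) p.580] -/
def G5 (c : ℝ) (x : HiggsLattice.Site P (i.j + 1)) : ℝ :=
  ∑ u ∈ i.L5, Real.exp (-(c * (HiggsLattice.Site.tdist x u : ℝ)))

/-- the profile `W(x,x′) = 1[x ∉ Λ₄]·G5_{δ/4}(x) + 1[x′ ∈ Λ₃] + 1[x ∈ Λ₃]`. [cite: Balaban1982Higgs2, (2.108) p.580] -/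
def W (δ : ℝ) (x x' : HiggsLattice.Site P (i.j + 1)) : ℝ :=
  (if x ∉ i.L4 then G5 i (δ / 4) x else 0) + (if x' ∈ i.L3 then 1 else 0) + (if x ∈ i.L3 then 1 else 0)

/-- `G5 ≥ 0`. [cite: Balaban1982Higgs2, (2.108) p.580] -/
theorem G5_nonneg (c : ℝ) (x : HiggsLattice.Site P (i.j + 1)) : 0 ≤ G5 i c x :=
  Finset.sum_nonneg fun _ _ => (Real.exp_pos _).le

/-- the three summands of `W` are `≥ 0`. [cite: Balaban1982Higgs2, (2.108) p.580] -/
theorem W_parts_nonneg (δ : ℝ) (x x' : HiggsLattice.Site P (i.j + 1)) :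
    0 ≤ (if x ∉ i.L4 then G5 i (δ / 4) x else 0) ∧ 0 ≤ (if x' ∈ i.L3 then (1 : ℝ) else 0) ∧
      0 ≤ (if x ∈ i.L3 then (1 : ℝ) else 0) := by
  refine ⟨?_, ?_, ?_⟩ <;> split_ifs <;> first | exact G5_nonneg i _ _ | norm_num

/-- `W ≥ 0`. [cite: Balaban1982Higgs2, (2.108) p.580] -/
theorem W_nonneg (δ : ℝ) (x x' : HiggsLattice.Site P (i.j + 1)) : 0 ≤ W i δ x x' := by
  obtain ⟨h1, h2, h3⟩ := W_parts_nonneg i δ x x'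
  unfold W
  linarith

/-- `dist(y, Λ₅) ≤ |y − u|` for `u ∈ Λ₅`. [cite: Balaban1982Higgs2, (2.8) p.558] -/
theorem d5_le {y u : HiggsLattice.Site P (i.j + 1)} (hu : u ∈ i.L5) : d5 i y ≤ (HiggsLattice.Site.tdist y u : ℝ) := by
  unfold d5
  rw [dif_pos ⟨u, hu⟩]
  exact Finset.inf'_le _ hu

/-- `dist(y, Λ₅) ≥ 0`. [cite: Balaban1982Higgs2, (2.8) p.558] -/
theorem d5_nonneg (y : HiggsLattice.Site P (i.j + 1)) : 0 ≤ d5 i y := by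
  unfold d5
  split_ifs with h
  · exact (Finset.le_inf'_iff h _).2 fun u _ => Nat.cast_nonneg _
  · exact le_rfl

/-- on `Λ₆′ ∖ Λ₄`, `dist(y, Λ₅) ≥ r` when `Λ₅ ≠ ∅` ((2.8): `sep45`). [cite: Balaban1982Higgs2, (2.8) p.558] -/
theorem r_le_d5 {a : ℝ} (hA : Adm a i) (h5 : i.L5.Nonempty) {y : HiggsLattice.Site P (i.j + 1)} (hy : y ∈ i.L6)
    (hy4 : y ∉ i.L4) : i.r ≤ d5 i y := by
  unfold d5
  rw [dif_pos h5]
  exact (Finset.le_inf'_iff h5 _).2 fun u hu => hA.sep45 y hy hy4 u hu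

/-- `e^{−c·dist(x,Λ₅)} ≤ G5_c(x)` when `Λ₅ ≠ ∅` (the minimum is attained). [cite: Balaban1982Higgs2, (2.108) p.580] -/
theorem exp_d5_le_G5 (h5 : i.L5.Nonempty) (c : ℝ) (x : HiggsLattice.Site P (i.j + 1)) :
    Real.exp (-(c * d5 i x)) ≤ G5 i c x := by
  obtain ⟨u₀, hu₀, hmin⟩ := Finset.exists_mem_eq_inf' h5 (fun u => (HiggsLattice.Site.tdist x u : ℝ))
  have hd : d5 i x = (HiggsLattice.Site.tdist x u₀ : ℝ) := by
    unfold d5; rw [dif_pos h5]; exact hmin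
  rw [hd]
  unfold G5
  exact Finset.single_le_sum (f := fun u => Real.exp (-(c * (HiggsLattice.Site.tdist x u : ℝ))))
    (fun _ _ => (Real.exp_pos _).le) hu₀

/-- `w5` is an admissible weight for the pair `(Λ₂′ ∖ Λ₅) ⊆ Λ₂′` (below the distance to the defect `Λ₅`).
[cite: Balaban1982Higgs2, (2.8) p.558] -/
theorem w5_adm (y y' : HiggsLattice.Site P (i.j + 1)) (hy' : y' ∈ i.L2p) (hy'' : y' ∉ i.L2p \ i.L5) :
    w5 i y ≤ (HiggsLattice.Site.tdist y y' : ℝ) := by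
  unfold w5
  split_ifs with h
  · have h5 : y' ∈ i.L5 := by
      by_contra h5
      exact hy'' (Finset.mem_sdiff.2 ⟨hy', h5⟩)
    exact d5_le i h5
  · exact Nat.cast_nonneg _

/-- `w5 = dist(·, Λ₅)` on `Λ₆′ ∖ Λ₄`. [cite: Balaban1982Higgs2, (2.8) p.558] -/
theorem w5_eq {y : HiggsLattice.Site P (i.j + 1)} (hy : y ∈ i.L6) (hy4 : y ∉ i.L4) : w5 i y = d5 i y := by
  simp [w5, hy, hy4]

/-- if `Λ₅^{(k)} = ∅` the localization `Ω₁ = Ω` is void: `Δ(Ω₁) = Δ(Ω)` entrywise. [cite: Balaban1982Higgs2, (2.108) p.580] -/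
theorem D1_eq_DΩ_of_empty (a : ℝ) (h5 : i.L5 = ∅) (p q : ↥i.L6 × Ix N) : i.D1 a p q = i.DΩ a p q := by
  have hs : i.L2p \ i.L5 = i.L2p := by rw [h5, Finset.sdiff_empty]
  simp only [Inst.D1, Inst.DΩ, Inst.Ω₁, Inst.Ω, hs]

/-- the exponent bookkeeping of the damped blocks: for `δ, d ≥ 0`, `d′ ≥ r`:
`e^{−(δ/2)(D + d + d′)} ≤ e^{−(δ/2)r}·e^{−(δ/2)D}·e^{−(δ/4)d}`. [cite: Balaban1982Higgs2, (2.109) p.580] -/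
private theorem damped3_le {δ D d d' r : ℝ} (hδ : 0 ≤ δ) (hd : 0 ≤ d) (hd' : r ≤ d') :
    Real.exp (-(δ / 2 * (D + d + d'))) ≤
      Real.exp (-(δ / 2 * r)) * Real.exp (-(δ / 2 * D)) * Real.exp (-(δ / 4 * d)) := by
  rw [← Real.exp_add, ← Real.exp_add]
  refine Real.exp_le_exp.2 ?_
  nlinarith [mul_nonneg hδ hd, mul_le_mul_of_nonneg_left hd' hδ]

/-- `e^{−(δ/2)(D + r + r)} ≤ e^{−(δ/2)r}·e^{−(δ/2)D}` for `δ, r ≥ 0`. [cite: Balaban1982Higgs2, (2.109) p.580] -/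
private theorem damped_le {δ D r : ℝ} (hδ : 0 ≤ δ) (hr : 0 ≤ r) :
    Real.exp (-(δ / 2 * (D + r + r))) ≤ Real.exp (-(δ / 2 * r)) * Real.exp (-(δ / 2 * D)) := by
  rw [← Real.exp_add]
  refine Real.exp_le_exp.2 ?_
  nlinarith [mul_nonneg hδ hr]

/-- `e^{−δD} ≤ e^{−(δ/2)r}·e^{−(δ/2)D}` for `D ≥ r`, `δ ≥ 0`. [cite: Balaban1982Higgs2, (2.109) p.580] -/
private theorem far_le {δ D r : ℝ} (hδ : 0 ≤ δ) (hD : r ≤ D) :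
    Real.exp (-(δ * D)) ≤ Real.exp (-(δ / 2 * r)) * Real.exp (-(δ / 2 * D)) := by
  rw [← Real.exp_add]
  refine Real.exp_le_exp.2 ?_
  nlinarith [mul_le_mul_of_nonneg_left hD hδ]

/-- **THE REFINED KERNEL BOUND** `|h_k(x,x′)| ≤ (c₀^{(2.27)} + c₀^{(2.29)})(Lᵏε)⁻²·e^{−(δ/2)r}·e^{−(δ/2)|x−x′|}·W(x,x′)` for every
admissible step and every `δ ≥ 0` with `(4d + 4a)δ ≤ γ₀` — the block analysis of `Inst.abs_hk_le` with r14's (I.2.29) taken at the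
`x`-DEPENDENT weight `w5 = dist(·, Λ₅^{(k)})` on the `Δ(Ω) − Δ(Ω₁)` blocks. [cite: Balaban1982Higgs2, (2.108)–(2.109) p.580] -/
theorem abs_hk_le_W {a : ℝ} (ha : 0 < a) (hL : 1 < P.L) (hA : Adm a i) {δ : ℝ} (hδ0 : 0 ≤ δ)
    (hδ : (4 * P.d + 4 * a) * δ ≤ gam P.L a) (p q : ↥i.L6 × Ix N) :
    |i.hk a p q| ≤ (c227 P.L a δ + c229 P.d P.L a δ) * (P.mesh (i.j + 1))⁻¹ ^ 2 *
      Real.exp (-(δ / 2 * i.r)) * Real.exp (-(δ / 2 * (HiggsLattice.Site.tdist p.1.1 q.1.1 : ℝ))) * W i δ p.1.1 q.1.1 := by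
  have hγ : 0 < gam P.L a := gam_pos hL ha
  have hδ' : (4 * P.d + 4 * a) * δ ≤ min 2 (a * (1 - ((P.L : ℝ) ^ 2)⁻¹) / 4) := hδ
  have hM : 0 < (P.mesh (i.j + 1))⁻¹ ^ 2 := by
    have := P.mesh_pos (i.j + 1)
    positivity
  have h227 : 0 ≤ c227 P.L a δ := c227_nonneg hL ha δ
  have h229 : 0 ≤ c229 P.d P.L a δ := c229_nonneg P.d hL ha δ
  have hΩ : ∀ x, x ∈ i.Ω ↔ blockIter (i.j + 1) x ∈ i.L2p := i.mem_reg i.L2p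
  have hΩ₁ : ∀ x, x ∈ i.Ω₁ ↔ blockIter (i.j + 1) x ∈ i.L2p \ i.L5 := i.mem_reg _
  have hΩ₂ : ∀ x, x ∈ i.Ω₂ ↔ blockIter (i.j + 1) x ∈ i.L2k := i.mem_reg _
  have hc229 : a ^ 2 * ((Real.exp (6 * δ) * ((P.d + a / 2) * (2 / min 2 (a * (1 - ((P.L : ℝ) ^ 2)⁻¹) / 4)) ^ 2
        + (min 2 (a * (1 - ((P.L : ℝ) ^ 2)⁻¹) / 4))⁻¹)
        + 4 / min 2 (a * (1 - ((P.L : ℝ) ^ 2)⁻¹) / 4) * Real.exp δ) / 2) = c229 P.d P.L a δ := by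
    unfold c229 gam; ring
  have hc227 : (P.mesh (i.j + 1))⁻¹ ^ 2 * (a + a ^ 2 * (2 / min 2 (a * (1 - ((P.L : ℝ) ^ 2)⁻¹) / 4) * Real.exp δ))
      = c227 P.L a δ * (P.mesh (i.j + 1))⁻¹ ^ 2 := by
    unfold c227 gam; ring
  -- abbreviations for the common factor
  set Cst : ℝ := (c227 P.L a δ + c229 P.d P.L a δ) * (P.mesh (i.j + 1))⁻¹ ^ 2 with hCst
  have hCst0 : 0 ≤ Cst := by positivity
  have hWge : ∀ {x x' : HiggsLattice.Site P (i.j + 1)} {E : ℝ}, 0 ≤ E →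
      (x ∈ i.L3 ∨ x' ∈ i.L3) → E ≤ E * W i δ x x' := by
    intro x x' E hE hor
    obtain ⟨h1, h2, h3⟩ := W_parts_nonneg i δ x x'
    have hW1 : 1 ≤ W i δ x x' := by
      unfold W
      rcases hor with h | h
      · rw [if_pos h] at h3 ⊢; linarith
      · rw [if_pos h] at h2 ⊢; linarith
    nlinarith
  -- the `Δ(Ω) − Δ(Ω₁)` blocks (both points off `Λ₄`), damped by `G5(x)`
  have case1 : ∀ {p q : ↥i.L6 × Ix N}, p.1.1 ∉ i.L4 → q.1.1 ∉ i.L4 → i.hk a p q = i.DΩ a p q - i.D1 a p q →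
      |i.hk a p q| ≤ Cst * Real.exp (-(δ / 2 * i.r)) *
        Real.exp (-(δ / 2 * (HiggsLattice.Site.tdist p.1.1 q.1.1 : ℝ))) * W i δ p.1.1 q.1.1 := by
    intro p q hp4 hq4 hform
    have hrhs0 : 0 ≤ Cst * Real.exp (-(δ / 2 * i.r)) *
        Real.exp (-(δ / 2 * (HiggsLattice.Site.tdist p.1.1 q.1.1 : ℝ))) * W i δ p.1.1 q.1.1 :=
      mul_nonneg (by positivity) (W_nonneg i _ _ _)
    by_cases h5 : i.L5.Nonempty
    · have hp5 : p.1.1 ∈ i.L2p \ i.L5 := Finset.mem_sdiff.2 ⟨i.h6 p.1.2, fun h => hp4 (i.h54 h)⟩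
      have hq5 : q.1.1 ∈ i.L2p \ i.L5 := Finset.mem_sdiff.2 ⟨i.h6 q.1.2, fun h => hq4 (i.h54 h)⟩
      have h := ineq229_regular_region i.C ha hL i.hmsq i.j i.hjK i.Ω₁ i.Ω (i.L2p \ i.L5) i.L2p hΩ₁ hΩ Finset.sdiff_subset
        i.A hA.reg hA.small hδ0 hδ' (w5 i) (fun y y' hy' hy'' => w5_adm i y y' hy' hy'') (p.1.1, p.2) (q.1.1, q.2) hp5 hq5
      dsimp only at h
      rw [w5_eq i p.1.2 hp4, w5_eq i q.1.2 hq4, hc229] at h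
      rw [hform, abs_sub_comm]
      have hG : Real.exp (-(δ / 4 * d5 i p.1.1)) ≤ W i δ p.1.1 q.1.1 := by
        obtain ⟨-, h2, h3⟩ := W_parts_nonneg i δ p.1.1 q.1.1
        have := exp_d5_le_G5 i h5 (δ / 4) p.1.1
        unfold W
        rw [if_pos hp4]
        linarith
      calc |i.D1 a p q - i.DΩ a p q|
          ≤ c229 P.d P.L a δ * (P.mesh (i.j + 1))⁻¹ ^ 2 *
              Real.exp (-(δ / 2 * ((HiggsLattice.Site.tdist p.1.1 q.1.1 : ℝ) + d5 i p.1.1 + d5 i q.1.1))) := h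
        _ ≤ c229 P.d P.L a δ * (P.mesh (i.j + 1))⁻¹ ^ 2 *
              (Real.exp (-(δ / 2 * i.r)) * Real.exp (-(δ / 2 * (HiggsLattice.Site.tdist p.1.1 q.1.1 : ℝ))) *
                Real.exp (-(δ / 4 * d5 i p.1.1))) :=
            mul_le_mul_of_nonneg_left (damped3_le hδ0 (d5_nonneg i _) (r_le_d5 i hA h5 q.1.2 hq4)) (mul_nonneg h229 hM.le)
        _ ≤ c229 P.d P.L a δ * (P.mesh (i.j + 1))⁻¹ ^ 2 *
              (Real.exp (-(δ / 2 * i.r)) * Real.exp (-(δ / 2 * (HiggsLattice.Site.tdist p.1.1 q.1.1 : ℝ))) *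
                W i δ p.1.1 q.1.1) :=
            mul_le_mul_of_nonneg_left (mul_le_mul_of_nonneg_left hG (by positivity)) (mul_nonneg h229 hM.le)
        _ ≤ _ := by
            have hx : 0 ≤ (P.mesh (i.j + 1))⁻¹ ^ 2 * (Real.exp (-(δ / 2 * i.r)) *
                Real.exp (-(δ / 2 * (HiggsLattice.Site.tdist p.1.1 q.1.1 : ℝ))) * W i δ p.1.1 q.1.1) :=
              mul_nonneg hM.le (mul_nonneg (by positivity) (W_nonneg i _ _ _))
            rw [hCst]
            nlinarith [mul_nonneg h227 hx]
    · -- `Λ₅ = ∅`: the block vanishes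
      rw [Finset.not_nonempty_iff_eq_empty] at h5
      rw [hform, D1_eq_DΩ_of_empty i a h5, sub_self, abs_zero]
      exact hrhs0
  -- the `Δ(Ω)` blocks at separation `≥ r` with a point in `Λ₄ ⊆ Λ₃`
  have caseFar : ∀ {p q : ↥i.L6 × Ix N}, i.r ≤ (HiggsLattice.Site.tdist p.1.1 q.1.1 : ℝ) →
      (p.1.1 ∈ i.L3 ∨ q.1.1 ∈ i.L3) → i.hk a p q = i.DΩ a p q →
      |i.hk a p q| ≤ Cst * Real.exp (-(δ / 2 * i.r)) *
        Real.exp (-(δ / 2 * (HiggsLattice.Site.tdist p.1.1 q.1.1 : ℝ))) * W i δ p.1.1 q.1.1 := by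
    intro p q hfar hor hform
    have h := ineq227_regular_region_uniform i.C ha hL i.hmsq i.j i.hjK i.Ω i.L2p hΩ i.A hA.reg hA.small hδ0 hδ'
      (p.1.1, p.2) (q.1.1, q.2) (i.h6 p.1.2) (i.h6 q.1.2)
    dsimp only at h
    rw [hc227] at h
    rw [hform]
    calc |i.DΩ a p q|
        ≤ c227 P.L a δ * (P.mesh (i.j + 1))⁻¹ ^ 2 *
            Real.exp (-(δ * (HiggsLattice.Site.tdist p.1.1 q.1.1 : ℝ))) := h
      _ ≤ c227 P.L a δ * (P.mesh (i.j + 1))⁻¹ ^ 2 *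
            (Real.exp (-(δ / 2 * i.r)) * Real.exp (-(δ / 2 * (HiggsLattice.Site.tdist p.1.1 q.1.1 : ℝ)))) :=
          mul_le_mul_of_nonneg_left (far_le hδ0 hfar) (mul_nonneg h227 hM.le)
      _ ≤ Cst * Real.exp (-(δ / 2 * i.r)) * Real.exp (-(δ / 2 * (HiggsLattice.Site.tdist p.1.1 q.1.1 : ℝ))) := by
          have hx : 0 ≤ (P.mesh (i.j + 1))⁻¹ ^ 2 * (Real.exp (-(δ / 2 * i.r)) *
              Real.exp (-(δ / 2 * (HiggsLattice.Site.tdist p.1.1 q.1.1 : ℝ)))) := by positivity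
          rw [hCst]
          nlinarith [mul_nonneg h229 hx]
      _ ≤ _ := hWge (by positivity) hor
  by_cases hp3 : p.1.1 ∈ i.L3 <;> by_cases hq3 : q.1.1 ∈ i.L3
  · -- `Λ₃ × Λ₃`: `δΔ(Ω₂ ⊆ Ω)`
    have h := ineq229_regular_region i.C ha hL i.hmsq i.j i.hjK i.Ω₂ i.Ω i.L2k i.L2p hΩ₂ hΩ i.h2k
      i.A hA.reg hA.small hδ0 hδ' i.w2 (fun y y' hy' hy'' => w2_adm hA y y' hy' hy'') (p.1.1, p.2) (q.1.1, q.2)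
      (i.h32 hp3) (i.h32 hq3)
    dsimp only at h
    rw [w2_eq hp3, w2_eq hq3, hc229] at h
    rw [hk_33 hp3 hq3, abs_sub_comm]
    calc |i.D2 a p q - i.DΩ a p q|
        ≤ c229 P.d P.L a δ * (P.mesh (i.j + 1))⁻¹ ^ 2 *
            Real.exp (-(δ / 2 * ((HiggsLattice.Site.tdist p.1.1 q.1.1 : ℝ) + i.r + i.r))) := h
      _ ≤ c229 P.d P.L a δ * (P.mesh (i.j + 1))⁻¹ ^ 2 *
            (Real.exp (-(δ / 2 * i.r)) * Real.exp (-(δ / 2 * (HiggsLattice.Site.tdist p.1.1 q.1.1 : ℝ)))) :=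
          mul_le_mul_of_nonneg_left (damped_le hδ0 hA.hr) (mul_nonneg h229 hM.le)
      _ ≤ Cst * Real.exp (-(δ / 2 * i.r)) * Real.exp (-(δ / 2 * (HiggsLattice.Site.tdist p.1.1 q.1.1 : ℝ))) := by
          have hx : 0 ≤ (P.mesh (i.j + 1))⁻¹ ^ 2 * (Real.exp (-(δ / 2 * i.r)) *
              Real.exp (-(δ / 2 * (HiggsLattice.Site.tdist p.1.1 q.1.1 : ℝ)))) := by positivity
          rw [hCst]
          nlinarith [mul_nonneg h227 hx]
      _ ≤ _ := hWge (by positivity) (Or.inl hp3)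
  · -- `Λ₃ × P`
    by_cases hp4 : p.1.1 ∈ i.L4
    · refine caseFar ?_ (Or.inl hp3) (hk_4P hp4 hq3)
      rw [tdist_comm]
      exact hA.sep34 q.1.1 q.1.2 hq3 p.1.1 hp4
    · exact case1 hp4 (fun h => hq3 (i.h43 h)) (hk_34P hp3 hp4 hq3)
  · -- `P × Λ₃`
    by_cases hq4 : q.1.1 ∈ i.L4
    · exact caseFar (hA.sep34 p.1.1 p.1.2 hp3 q.1.1 hq4) (Or.inr hq3) (hk_P4 hp3 hq4)
    · exact case1 (fun h => hp3 (i.h43 h)) hq4 (hk_P34 hp3 hq3 hq4)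
  · -- `P × P`
    exact case1 (fun h => hp3 (i.h43 h)) (fun h => hq3 (i.h43 h)) (hk_PP hp3 hq3)

/-! ## §2 The torus sums of the profile -/

/-- `Σ_x G5_c(x) ≤ |Λ₅^{(k)}|·K_d(c)` (torus sums, volume-uniform). [cite: Balaban1982Higgs2, (2.108) p.580] -/
theorem sum_G5_le {c : ℝ} (hc : 0 < c) :
    ∑ x : HiggsLattice.Site P (i.j + 1), G5 i c x ≤ (i.L5.card : ℝ) * B4Sect5Proof.latticeConst P.d c := by
  unfold G5
  rw [Finset.sum_comm]
  calc ∑ u ∈ i.L5, ∑ x : HiggsLattice.Site P (i.j + 1), Real.exp (-(c * (HiggsLattice.Site.tdist x u : ℝ)))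
      ≤ ∑ _u ∈ i.L5, B4Sect5Proof.latticeConst P.d c := by
        refine Finset.sum_le_sum fun u _ => ?_
        have h := B2Eq230CondShiftBound.sum_exp_neg_tdist_le (P := P) (k := i.j + 1) hc u
        refine le_trans (le_of_eq ?_) h
        exact Finset.sum_congr rfl fun x _ => by rw [tdist_comm]
    _ = (i.L5.card : ℝ) * B4Sect5Proof.latticeConst P.d c := by
        rw [Finset.sum_const, nsmul_eq_mul]

/-- the sums constant `K_d(δ/2)·(K_d(δ/4) + 2)`. [cite: Balaban1982Higgs2, (2.108) p.580] -/
def KW (d : ℕ) (δ : ℝ) : ℝ := B4Sect5Proof.latticeConst d (δ / 2) * (B4Sect5Proof.latticeConst d (δ / 4) + 2)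

/-- `K_W ≥ 0`. [cite: Balaban1982Higgs2, (2.108) p.580] -/
theorem KW_nonneg (d : ℕ) {δ : ℝ} (hδ : 0 < δ) : 0 ≤ KW d δ := by
  unfold KW
  have h1 := B4Sect5Proof.latticeConst_nonneg d (show 0 ≤ δ / 2 by positivity)
  have h2 := B4Sect5Proof.latticeConst_nonneg d (show 0 ≤ δ / 4 by positivity)
  positivity

/-- **THE PROFILE SUMS TO `O(1)|Λ₃^{(k)}|`**: `Σ_{x,x′∈Λ₆′} e^{−(δ/2)|x−x′|}W(x,x′) ≤ K_d(δ/2)(K_d(δ/4) + 2)·|Λ₃^{(k)}|`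
(`|Λ₅| ≤ |Λ₃|`; torus sums). [cite: Balaban1982Higgs2, (2.108) p.580] -/
theorem sum_W_le {δ : ℝ} (hδ : 0 < δ) :
    ∑ x ∈ i.L6, ∑ x' ∈ i.L6, Real.exp (-(δ / 2 * (HiggsLattice.Site.tdist x x' : ℝ))) * W i δ x x'
      ≤ KW P.d δ * (i.L3.card : ℝ) := by
  set K2 := B4Sect5Proof.latticeConst P.d (δ / 2) with hK2
  set K4 := B4Sect5Proof.latticeConst P.d (δ / 4) with hK4
  have hK2n : 0 ≤ K2 := B4Sect5Proof.latticeConst_nonneg P.d (show 0 ≤ δ / 2 by positivity)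
  have hK4n : 0 ≤ K4 := B4Sect5Proof.latticeConst_nonneg P.d (show 0 ≤ δ / 4 by positivity)
  have hδ2 : 0 < δ / 2 := by positivity
  have hδ4 : 0 < δ / 4 := by positivity
  -- row sums of the exponential
  have hrow : ∀ x : HiggsLattice.Site P (i.j + 1),
      ∑ x' ∈ i.L6, Real.exp (-(δ / 2 * (HiggsLattice.Site.tdist x x' : ℝ))) ≤ K2 := fun x =>
    (Finset.sum_le_univ_sum_of_nonneg fun _ => (Real.exp_pos _).le).trans
      (B2Eq230CondShiftBound.sum_exp_neg_tdist_le hδ2 x)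
  have hcol : ∀ x' : HiggsLattice.Site P (i.j + 1),
      ∑ x ∈ i.L6, Real.exp (-(δ / 2 * (HiggsLattice.Site.tdist x x' : ℝ))) ≤ K2 := by
    intro x'
    have := hrow x'
    calc ∑ x ∈ i.L6, Real.exp (-(δ / 2 * (HiggsLattice.Site.tdist x x' : ℝ)))
        = ∑ x ∈ i.L6, Real.exp (-(δ / 2 * (HiggsLattice.Site.tdist x' x : ℝ))) :=
          Finset.sum_congr rfl fun x _ => by rw [tdist_comm]
      _ ≤ K2 := this
  -- split the profile
  have hsplit : ∀ x x' : HiggsLattice.Site P (i.j + 1),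
      Real.exp (-(δ / 2 * (HiggsLattice.Site.tdist x x' : ℝ))) * W i δ x x' ≤
        Real.exp (-(δ / 2 * (HiggsLattice.Site.tdist x x' : ℝ))) * G5 i (δ / 4) x +
        Real.exp (-(δ / 2 * (HiggsLattice.Site.tdist x x' : ℝ))) * (if x' ∈ i.L3 then 1 else 0) +
        Real.exp (-(δ / 2 * (HiggsLattice.Site.tdist x x' : ℝ))) * (if x ∈ i.L3 then 1 else 0) := by
    intro x x'
    have he : 0 ≤ Real.exp (-(δ / 2 * (HiggsLattice.Site.tdist x x' : ℝ))) := (Real.exp_pos _).le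
    have hG : (if x ∉ i.L4 then G5 i (δ / 4) x else 0) ≤ G5 i (δ / 4) x := by
      split_ifs <;> first | exact le_rfl | exact G5_nonneg i _ _
    unfold W
    nlinarith [mul_le_mul_of_nonneg_left hG he]
  -- the three sums
  have hS1 : ∑ x ∈ i.L6, ∑ x' ∈ i.L6, Real.exp (-(δ / 2 * (HiggsLattice.Site.tdist x x' : ℝ))) * G5 i (δ / 4) x
      ≤ K2 * ((i.L5.card : ℝ) * K4) := by
    calc ∑ x ∈ i.L6, ∑ x' ∈ i.L6, Real.exp (-(δ / 2 * (HiggsLattice.Site.tdist x x' : ℝ))) * G5 i (δ / 4) x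
        = ∑ x ∈ i.L6, (∑ x' ∈ i.L6, Real.exp (-(δ / 2 * (HiggsLattice.Site.tdist x x' : ℝ)))) * G5 i (δ / 4) x := by
          refine Finset.sum_congr rfl fun x _ => ?_
          rw [Finset.sum_mul]
      _ ≤ ∑ x ∈ i.L6, K2 * G5 i (δ / 4) x :=
          Finset.sum_le_sum fun x _ => mul_le_mul_of_nonneg_right (hrow x) (G5_nonneg i _ _)
      _ ≤ ∑ x : HiggsLattice.Site P (i.j + 1), K2 * G5 i (δ / 4) x :=
          Finset.sum_le_univ_sum_of_nonneg fun x => mul_nonneg hK2n (G5_nonneg i _ _)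
      _ = K2 * ∑ x : HiggsLattice.Site P (i.j + 1), G5 i (δ / 4) x := by rw [Finset.mul_sum]
      _ ≤ K2 * ((i.L5.card : ℝ) * K4) := mul_le_mul_of_nonneg_left (sum_G5_le i hδ4) hK2n
  have hS2 : ∑ x ∈ i.L6, ∑ x' ∈ i.L6,
      Real.exp (-(δ / 2 * (HiggsLattice.Site.tdist x x' : ℝ))) * (if x' ∈ i.L3 then (1 : ℝ) else 0)
      ≤ (i.L3.card : ℝ) * K2 := by
    rw [Finset.sum_comm]
    have hterm : ∀ x' ∈ i.L6, ∑ x ∈ i.L6,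
        Real.exp (-(δ / 2 * (HiggsLattice.Site.tdist x x' : ℝ))) * (if x' ∈ i.L3 then (1 : ℝ) else 0)
        ≤ (if x' ∈ i.L3 then (1 : ℝ) else 0) * K2 := by
      intro x' _
      rw [← Finset.sum_mul, mul_comm]
      refine mul_le_mul_of_nonneg_left (hcol x') ?_
      split_ifs <;> norm_num
    refine (Finset.sum_le_sum hterm).trans ?_
    rw [← Finset.sum_mul]
    refine mul_le_mul_of_nonneg_right ?_ hK2n
    calc ∑ x' ∈ i.L6, (if x' ∈ i.L3 then (1 : ℝ) else 0)
        = ((i.L6.filter fun x' => x' ∈ i.L3).card : ℝ) := by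
          rw [Finset.sum_ite, Finset.sum_const_zero, add_zero, Finset.sum_const, nsmul_eq_mul, mul_one]
      _ ≤ (i.L3.card : ℝ) := by
          exact_mod_cast Finset.card_le_card (fun x hx => (Finset.mem_filter.1 hx).2)
  have hS3 : ∑ x ∈ i.L6, ∑ x' ∈ i.L6,
      Real.exp (-(δ / 2 * (HiggsLattice.Site.tdist x x' : ℝ))) * (if x ∈ i.L3 then (1 : ℝ) else 0)
      ≤ (i.L3.card : ℝ) * K2 := by
    have hterm : ∀ x ∈ i.L6, ∑ x' ∈ i.L6,
        Real.exp (-(δ / 2 * (HiggsLattice.Site.tdist x x' : ℝ))) * (if x ∈ i.L3 then (1 : ℝ) else 0)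
        ≤ (if x ∈ i.L3 then (1 : ℝ) else 0) * K2 := by
      intro x _
      rw [← Finset.sum_mul, mul_comm]
      refine mul_le_mul_of_nonneg_left (hrow x) ?_
      split_ifs <;> norm_num
    refine (Finset.sum_le_sum hterm).trans ?_
    rw [← Finset.sum_mul]
    refine mul_le_mul_of_nonneg_right ?_ hK2n
    calc ∑ x ∈ i.L6, (if x ∈ i.L3 then (1 : ℝ) else 0)
        = ((i.L6.filter fun x => x ∈ i.L3).card : ℝ) := by
          rw [Finset.sum_ite, Finset.sum_const_zero, add_zero, Finset.sum_const, nsmul_eq_mul, mul_one]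
      _ ≤ (i.L3.card : ℝ) := by
          exact_mod_cast Finset.card_le_card (fun x hx => (Finset.mem_filter.1 hx).2)
  have h53 : (i.L5.card : ℝ) ≤ (i.L3.card : ℝ) := by
    exact_mod_cast Finset.card_le_card (i.h54.trans i.h43)
  calc ∑ x ∈ i.L6, ∑ x' ∈ i.L6, Real.exp (-(δ / 2 * (HiggsLattice.Site.tdist x x' : ℝ))) * W i δ x x'
      ≤ ∑ x ∈ i.L6, ∑ x' ∈ i.L6,
          (Real.exp (-(δ / 2 * (HiggsLattice.Site.tdist x x' : ℝ))) * G5 i (δ / 4) x +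
           Real.exp (-(δ / 2 * (HiggsLattice.Site.tdist x x' : ℝ))) * (if x' ∈ i.L3 then 1 else 0) +
           Real.exp (-(δ / 2 * (HiggsLattice.Site.tdist x x' : ℝ))) * (if x ∈ i.L3 then 1 else 0)) :=
        Finset.sum_le_sum fun x _ => Finset.sum_le_sum fun x' _ => hsplit x x'
    _ = (∑ x ∈ i.L6, ∑ x' ∈ i.L6, Real.exp (-(δ / 2 * (HiggsLattice.Site.tdist x x' : ℝ))) * G5 i (δ / 4) x) +
        (∑ x ∈ i.L6, ∑ x' ∈ i.L6,
          Real.exp (-(δ / 2 * (HiggsLattice.Site.tdist x x' : ℝ))) * (if x' ∈ i.L3 then (1 : ℝ) else 0)) +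
        (∑ x ∈ i.L6, ∑ x' ∈ i.L6,
          Real.exp (-(δ / 2 * (HiggsLattice.Site.tdist x x' : ℝ))) * (if x ∈ i.L3 then (1 : ℝ) else 0)) := by
        simp only [Finset.sum_add_distrib]
    _ ≤ K2 * ((i.L5.card : ℝ) * K4) + (i.L3.card : ℝ) * K2 + (i.L3.card : ℝ) * K2 := add_le_add (add_le_add hS1 hS2) hS3
    _ ≤ K2 * ((i.L3.card : ℝ) * K4) + (i.L3.card : ℝ) * K2 + (i.L3.card : ℝ) * K2 := by
        nlinarith [mul_le_mul_of_nonneg_right h53 hK4n]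
    _ = KW P.d δ * (i.L3.card : ℝ) := by rw [KW, ← hK2, ← hK4]; ring

/-! ## §3 The error term of (2.108) -/

/-- `|⟨φ,Kφ⟩| ≤ t²Σ|K|` when `|φ| ≤ t` pointwise. [cite: Balaban1982Higgs2, (2.108) p.580] -/
private theorem abs_form_le_sq_mul_sum {X : Type} [Fintype X] (K : Matrix X X ℝ) {t : ℝ} (φ : X → ℝ)
    (hφ : ∀ p, |φ p| ≤ t) : |φ ⬝ᵥ (K *ᵥ φ)| ≤ t ^ 2 * ∑ p, ∑ q, |K p q| := by
  rw [Finset.mul_sum]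
  refine (Finset.abs_sum_le_sum_abs _ _).trans (Finset.sum_le_sum fun p _ => ?_)
  rw [Finset.mul_sum, Matrix.mulVec, dotProduct, Finset.mul_sum]
  refine (Finset.abs_sum_le_sum_abs _ _).trans (Finset.sum_le_sum fun q _ => ?_)
  rw [abs_mul, abs_mul]
  have hp := hφ p; have hq := hφ q
  have h0 : 0 ≤ |φ p| := abs_nonneg _
  have h1 : 0 ≤ |φ q| := abs_nonneg _
  have hK := abs_nonneg (K p q)
  calc |φ p| * (|K p q| * |φ q|) = (|φ p| * |φ q|) * |K p q| := by ring
    _ ≤ (t * t) * |K p q| := mul_le_mul_of_nonneg_right (mul_le_mul hp hq h1 (h0.trans hp)) hK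
    _ = t ^ 2 * |K p q| := by ring

/-- a sum over `X = Λ₆′ × {1,…,N}` of a function of the site only. [cite: Balaban1982Higgs2, (2.108) p.580] -/
private theorem sum_prod_site (f : HiggsLattice.Site P (i.j + 1) → ℝ) :
    ∑ p : ↥i.L6 × Ix N, f p.1.1 = (Fintype.card (Ix N) : ℝ) * ∑ x ∈ i.L6, f x := by
  rw [Fintype.sum_prod_type]
  simp only [Finset.sum_const, Finset.card_univ, nsmul_eq_mul]
  rw [← Finset.mul_sum, Finset.sum_coe_sort i.L6 f]

/-- **THE ERROR TERM OF (2.108) FOR THE CONCRETE `H_k` OF THE CARRIER, EXPLICIT** (p. 580: *"+ O((Lᵏε)^κ)|Λ₃^{(k)}|"*, obtained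
*"using Proposition I.2.2 and the restrictions on the fields ψ, φ"*): for `a > 0`, `L > 1`, every admissible step, every `δ > 0` with
`(4d + 4a)δ ≤ γ₀` and every `φ` on `Λ₆^{(k−1)′} × {1,…,N}` with `|φ| ≤ t` pointwise,
`|⟨Λ₆′φ, H_kΛ₆′φ⟩| ≤ (c₀^{(2.27)} + c₀^{(2.29)})·N²·K_W(δ)·(Lᵏε)⁻²·t²·e^{−(δ/2)r}·|Λ₃^{(k)}|`. [cite: Balaban1982Higgs2, (2.108) p.580] -/
theorem abs_form_hk_le {a : ℝ} (ha : 0 < a) (hL : 1 < P.L) (hA : Adm a i) {δ : ℝ} (hδ0 : 0 < δ)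
    (hδ : (4 * P.d + 4 * a) * δ ≤ gam P.L a) {t : ℝ} (φ : ↥i.L6 × Ix N → ℝ) (hφ : ∀ p, |φ p| ≤ t) :
    |φ ⬝ᵥ (i.Hk a *ᵥ φ)| ≤ (c227 P.L a δ + c229 P.d P.L a δ) * (Fintype.card (Ix N) : ℝ) ^ 2 * KW P.d δ *
      (P.mesh (i.j + 1))⁻¹ ^ 2 * t ^ 2 * Real.exp (-(δ / 2 * i.r)) * (i.L3.card : ℝ) := by
  set Cst : ℝ := (c227 P.L a δ + c229 P.d P.L a δ) * (P.mesh (i.j + 1))⁻¹ ^ 2 with hCst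
  have h227 : 0 ≤ c227 P.L a δ := c227_nonneg hL ha δ
  have h229 : 0 ≤ c229 P.d P.L a δ := c229_nonneg P.d hL ha δ
  have hCst0 : 0 ≤ Cst := by positivity
  have hpt := fun p q => abs_hk_le_W i ha hL hA hδ0.le hδ p q
  set E : ℝ := Real.exp (-(δ / 2 * i.r)) with hE
  have hE0 : 0 ≤ E := (Real.exp_pos _).le
  have hsum : ∑ p : ↥i.L6 × Ix N, ∑ q : ↥i.L6 × Ix N, |i.Hk a p q|
      ≤ Cst * E * (Fintype.card (Ix N) : ℝ) ^ 2 *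
          ∑ x ∈ i.L6, ∑ x' ∈ i.L6, Real.exp (-(δ / 2 * (HiggsLattice.Site.tdist x x' : ℝ))) * W i δ x x' := by
    calc ∑ p : ↥i.L6 × Ix N, ∑ q : ↥i.L6 × Ix N, |i.Hk a p q|
        ≤ ∑ p : ↥i.L6 × Ix N, ∑ q : ↥i.L6 × Ix N,
            Cst * E * Real.exp (-(δ / 2 * (HiggsLattice.Site.tdist p.1.1 q.1.1 : ℝ))) * W i δ p.1.1 q.1.1 :=
          Finset.sum_le_sum fun p _ => Finset.sum_le_sum fun q _ => hpt p q
      _ = Cst * E * (Fintype.card (Ix N) : ℝ) ^ 2 *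
          ∑ x ∈ i.L6, ∑ x' ∈ i.L6, Real.exp (-(δ / 2 * (HiggsLattice.Site.tdist x x' : ℝ))) * W i δ x x' := by
          have inner : ∀ p : ↥i.L6 × Ix N, ∑ q : ↥i.L6 × Ix N,
              Cst * E * Real.exp (-(δ / 2 * (HiggsLattice.Site.tdist p.1.1 q.1.1 : ℝ))) * W i δ p.1.1 q.1.1
              = (Fintype.card (Ix N) : ℝ) * ∑ x' ∈ i.L6,
                  Cst * E * Real.exp (-(δ / 2 * (HiggsLattice.Site.tdist p.1.1 x' : ℝ))) * W i δ p.1.1 x' :=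
            fun p => sum_prod_site i (fun x' =>
              Cst * E * Real.exp (-(δ / 2 * (HiggsLattice.Site.tdist p.1.1 x' : ℝ))) * W i δ p.1.1 x')
          simp_rw [inner]
          rw [← Finset.mul_sum, sum_prod_site i (fun x => ∑ x' ∈ i.L6,
            Cst * E * Real.exp (-(δ / 2 * (HiggsLattice.Site.tdist x x' : ℝ))) * W i δ x x')]
          simp only [Finset.mul_sum]
          refine Finset.sum_congr rfl fun x _ => Finset.sum_congr rfl fun x' _ => ?_
          ring
  have hW := sum_W_le i hδ0
  have hform := abs_form_le_sq_mul_sum (i.Hk a) φ hφ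
  have ht2 : 0 ≤ t ^ 2 := sq_nonneg t
  have hpre : 0 ≤ Cst * E * (Fintype.card (Ix N) : ℝ) ^ 2 := by positivity
  calc |φ ⬝ᵥ (i.Hk a *ᵥ φ)| ≤ t ^ 2 * ∑ p, ∑ q, |i.Hk a p q| := hform
    _ ≤ t ^ 2 * (Cst * E * (Fintype.card (Ix N) : ℝ) ^ 2 * (KW P.d δ * (i.L3.card : ℝ))) :=
        mul_le_mul_of_nonneg_left (hsum.trans (mul_le_mul_of_nonneg_left hW hpre)) ht2
    _ = _ := by rw [hCst, hE]; ring

/-- **THE ERROR TERM OF (2.108) IN THE PRINTED QUANTIFIER SHAPE on the (Higgs)₂,₃ carrier**: for every `d`, `L > 1`, `a > 0` there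
are `C, δ₁ > 0` (functions of `d, L, a` only) such that for EVERY torus of the model with these `d, L`, every `N`, charge, mass,
level, admissible system of sets and regular field, and every `φ` on `Λ₆^{(k−1)′} × {1,…,N}` with `|φ| ≤ t`:
`|⟨Λ₆′φ, H_kΛ₆′φ⟩| ≤ C·N²·(Lᵏε)⁻²·t²·e^{−δ₁r}·|Λ₃^{(k)}|`. [cite: Balaban1982Higgs2, (2.108) p.580] -/
theorem abs_form_hk_le_explicit (d L : ℕ) (hL : 1 < L) {a : ℝ} (ha : 0 < a) :
    ∃ C δ₁ : ℝ, 0 < C ∧ 0 < δ₁ ∧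
      ∀ (P : HiggsLattice.Params), P.d = d → P.L = L → ∀ (N : ℕ) (i : Inst P N), Adm a i →
        ∀ (t : ℝ) (φ : ↥i.L6 × Ix N → ℝ), (∀ p, |φ p| ≤ t) →
          |φ ⬝ᵥ (i.Hk a *ᵥ φ)| ≤ C * (Fintype.card (Ix N) : ℝ) ^ 2 * (P.mesh (i.j + 1))⁻¹ ^ 2 * t ^ 2 *
            Real.exp (-(δ₁ * i.r)) * (i.L3.card : ℝ) := by
  have hγ : 0 < gam L a := gam_pos hL ha
  have hden : (0 : ℝ) < 4 * d + 4 * a := by positivity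
  set δ := gam L a / (4 * d + 4 * a) with hδdef
  have hδ0 : 0 < δ := div_pos hγ hden
  have hKW := KW_nonneg d hδ0
  refine ⟨(c227 L a δ + c229 d L a δ) * KW d δ + 1, δ / 2,
    by nlinarith [mul_nonneg (add_nonneg (c227_nonneg hL ha δ) (c229_nonneg d hL ha δ)) hKW], by positivity, ?_⟩
  intro P hPd hPL N i hA t φ hφ
  subst hPd hPL
  have hδ' : (4 * P.d + 4 * a) * δ ≤ gam P.L a := by
    rw [hδdef, mul_div_cancel₀ _ hden.ne']
  have h := abs_form_hk_le i ha hL hA hδ0 hδ' φ hφ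
  refine h.trans ?_
  have hx : 0 ≤ (Fintype.card (Ix N) : ℝ) ^ 2 * (P.mesh (i.j + 1))⁻¹ ^ 2 * t ^ 2 *
      Real.exp (-(δ / 2 * i.r)) * (i.L3.card : ℝ) := by positivity
  nlinarith [hx]

/-- **«O((Lᵏε)^κ)|Λ₃^{(k)}|» FOR ARBITRARY `κ`** (unit-lattice form `(Lᵏε)²⟨φ, H_kφ⟩`, (I.2.22)): with `r = r(Lᵏε)` of (2.7) in the
printed ranges (`B2.Params.Printed`), `0 < Lᵏε ≤ 1` and a field threshold of polynomial growth `t ≤ T·(Lᵏε)^{−m}`, for every `κ`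
there is `C′` (depending on `d, L, a, N, T, m, κ` and the printed constants) with `(Lᵏε)²|⟨Λ₆′φ, H_kΛ₆′φ⟩| ≤ C′(Lᵏε)^κ|Λ₃^{(k)}|`
— r14's `B2StepK.rDecayBeatsPowers_of_printed`. [cite: Balaban1982Higgs2, (2.108) p.580, (2.7) p.558] -/
theorem abs_form_hk_le_pow (d L : ℕ) (hL : 1 < L) {a : ℝ} (ha : 0 < a) (N : ℕ) (Q : B2.Params) (hQ : Q.Printed)
    {T : ℝ} (hT : 0 ≤ T) (m κ : ℝ) :
    ∃ C' : ℝ, ∀ (P : HiggsLattice.Params), P.d = d → P.L = L → ∀ (i : Inst P N), Adm a i →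
      0 < P.mesh (i.j + 1) → P.mesh (i.j + 1) ≤ 1 → i.r = B2.rFn Q.R Q.r (P.mesh (i.j + 1)) →
        ∀ (t : ℝ) (φ : ↥i.L6 × Ix N → ℝ), 0 ≤ t → t ≤ T * P.mesh (i.j + 1) ^ (-m) → (∀ p, |φ p| ≤ t) →
          P.mesh (i.j + 1) ^ 2 * |φ ⬝ᵥ (i.Hk a *ᵥ φ)| ≤ C' * P.mesh (i.j + 1) ^ κ * (i.L3.card : ℝ) := by
  obtain ⟨C, δ₁, hC, hδ₁, h⟩ := abs_form_hk_le_explicit d L hL ha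
  obtain ⟨Cκ, hCκ⟩ := B2StepK.rDecayBeatsPowers_of_printed Q hQ hδ₁ (κ + 2 * m)
  refine ⟨C * (Fintype.card (Ix N) : ℝ) ^ 2 * T ^ 2 * Cκ, fun P hd hL' i hA hs hs1 hr t φ ht htT hφ => ?_⟩
  set s := P.mesh (i.j + 1) with hsdef
  have h1 := h P hd hL' N i hA t φ hφ
  have h2 := hCκ s hs hs1
  rw [← hr] at h2
  have hCκ0 : 0 ≤ Cκ := by
    have := (Real.exp_pos (-(δ₁ * i.r))).le.trans h2
    have hsp : 0 < s ^ (κ + 2 * m) := Real.rpow_pos_of_pos hs _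
    nlinarith
  have ht2 : t ^ 2 ≤ T ^ 2 * s ^ (-(2 * m)) := by
    have hsm : 0 ≤ T * s ^ (-m) := mul_nonneg hT (Real.rpow_nonneg hs.le _)
    have := pow_le_pow_left₀ ht htT 2
    calc t ^ 2 ≤ (T * s ^ (-m)) ^ 2 := this
      _ = T ^ 2 * s ^ (-(2 * m)) := by
          rw [mul_pow]
          congr 1
          rw [← Real.rpow_natCast (s ^ (-m)) 2, ← Real.rpow_mul hs.le]
          congr 1
          push_cast
          ring
  have hL3 : 0 ≤ (i.L3.card : ℝ) := Nat.cast_nonneg _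
  have hN : 0 ≤ (Fintype.card (Ix N) : ℝ) ^ 2 := sq_nonneg _
  have hpow : s ^ 2 * (s⁻¹ ^ 2 * (s ^ (-(2 * m)) * s ^ (κ + 2 * m))) = s ^ κ := by
    rw [← Real.rpow_add hs, inv_pow, ← mul_assoc, mul_inv_cancel₀ (pow_ne_zero 2 hs.ne'), one_mul]
    ring_nf
  calc s ^ 2 * |φ ⬝ᵥ (i.Hk a *ᵥ φ)|
      ≤ s ^ 2 * (C * (Fintype.card (Ix N) : ℝ) ^ 2 * s⁻¹ ^ 2 * t ^ 2 * Real.exp (-(δ₁ * i.r)) * (i.L3.card : ℝ)) :=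
        mul_le_mul_of_nonneg_left h1 (sq_nonneg _)
    _ ≤ s ^ 2 * (C * (Fintype.card (Ix N) : ℝ) ^ 2 * s⁻¹ ^ 2 * (T ^ 2 * s ^ (-(2 * m))) * (Cκ * s ^ (κ + 2 * m)) *
          (i.L3.card : ℝ)) := by
        refine mul_le_mul_of_nonneg_left (mul_le_mul_of_nonneg_right ?_ hL3) (sq_nonneg _)
        have e0 := (Real.exp_pos (-(δ₁ * i.r))).le
        have hb : 0 ≤ C * (Fintype.card (Ix N) : ℝ) ^ 2 * s⁻¹ ^ 2 := by positivity
        have s0 : 0 ≤ T ^ 2 * s ^ (-(2 * m)) := mul_nonneg (sq_nonneg T) (Real.rpow_nonneg hs.le _)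
        calc C * (Fintype.card (Ix N) : ℝ) ^ 2 * s⁻¹ ^ 2 * t ^ 2 * Real.exp (-(δ₁ * i.r))
            ≤ C * (Fintype.card (Ix N) : ℝ) ^ 2 * s⁻¹ ^ 2 * (T ^ 2 * s ^ (-(2 * m))) * Real.exp (-(δ₁ * i.r)) :=
              mul_le_mul_of_nonneg_right (mul_le_mul_of_nonneg_left ht2 hb) e0
          _ ≤ C * (Fintype.card (Ix N) : ℝ) ^ 2 * s⁻¹ ^ 2 * (T ^ 2 * s ^ (-(2 * m))) * (Cκ * s ^ (κ + 2 * m)) :=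
              mul_le_mul_of_nonneg_left h2 (mul_nonneg hb s0)
    _ = C * (Fintype.card (Ix N) : ℝ) ^ 2 * T ^ 2 * Cκ * (s ^ 2 * (s⁻¹ ^ 2 * (s ^ (-(2 * m)) * s ^ (κ + 2 * m)))) *
          (i.L3.card : ℝ) := by ring
    _ = C * (Fintype.card (Ix N) : ℝ) ^ 2 * T ^ 2 * Cκ * s ^ κ * (i.L3.card : ℝ) := by rw [hpow]

/-- **THE ERROR TERM UNDER THE PRINTED RESTRICTION** (unit-lattice form): with `r = r(Lᵏε)` and `p(·)` of the printed ranges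
(`B2.Params.Printed`: `p > 2`, `r > 1`, `L > 1`, `b₀ > 0`, `R > 0`), `ℓ = Lᵏε ∈ (0,1]`, any `c₁λ ≥ 0` (`cl`), and
`|φ| ≤ c₁λ(L^{k−1}ε)^{−1/4}p(L^{k−1}ε)` on `Λ₆^{(k−1)′}` (`L^{k−1}ε = ℓ/L`): for every `κ` there is `C′` with
`(Lᵏε)²|⟨Λ₆′φ, H_kΛ₆′φ⟩| ≤ C′(Lᵏε)^κ|Λ₃^{(k)}|` for every admissible step — the printed *"+ O((Lᵏε)^κ)|Λ₃^{(k)}|"* of (2.108) with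
the printed restriction on `φ` (gen 7's `printedThreshold_le`: the threshold is `≤ (c₁λb₀L^{1/4+p})ℓ^{−(1/4+p)}`).
[cite: Balaban1982Higgs2, (2.108) p.580, (2.55) p.570] -/
theorem abs_form_hk_le_printed (d L : ℕ) (hL : 1 < L) {a : ℝ} (ha : 0 < a) (N : ℕ) (Q : B2.Params) (hQ : Q.Printed)
    {cl : ℝ} (hcl : 0 ≤ cl) (κ : ℝ) :
    ∃ C' : ℝ, ∀ (P : HiggsLattice.Params), P.d = d → P.L = L → ∀ (i : Inst P N), Adm a i →
      0 < P.mesh (i.j + 1) → P.mesh (i.j + 1) ≤ 1 → i.r = B2.rFn Q.R Q.r (P.mesh (i.j + 1)) →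
        ∀ (φ : ↥i.L6 × Ix N → ℝ),
          (∀ p, |φ p| ≤ cl * (P.mesh (i.j + 1) / Q.L) ^ (-(1 / 4 : ℝ)) * B2.pFn Q.b₀ Q.p (P.mesh (i.j + 1) / Q.L)) →
          P.mesh (i.j + 1) ^ 2 * |φ ⬝ᵥ (i.Hk a *ᵥ φ)| ≤ C' * P.mesh (i.j + 1) ^ κ * (i.L3.card : ℝ) := by
  obtain ⟨hp2, -, hL1, -, -, -, hb0, -⟩ := id hQ
  have hT : 0 ≤ cl * Q.b₀ * (Q.L : ℝ) ^ (1 / 4 + Q.p) :=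
    mul_nonneg (mul_nonneg hcl hb0.le) (Real.rpow_nonneg (Nat.cast_nonneg _) _)
  obtain ⟨C', h⟩ := abs_form_hk_le_pow d L hL ha N Q hQ hT (1 / 4 + Q.p) κ
  refine ⟨C', fun P hd hL' i hA hs hs1 hr φ hφ => ?_⟩
  have hQL : (1 : ℝ) ≤ Q.L := by exact_mod_cast hL1.le
  have ht0 : 0 ≤ cl * (P.mesh (i.j + 1) / Q.L) ^ (-(1 / 4 : ℝ)) * B2.pFn Q.b₀ Q.p (P.mesh (i.j + 1) / Q.L) := by
    have hx : 0 < P.mesh (i.j + 1) / Q.L := div_pos hs (by linarith)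
    have hx1 : P.mesh (i.j + 1) / Q.L ≤ 1 := by rw [div_le_one (by linarith)]; linarith
    have hp : 0 ≤ B2.pFn Q.b₀ Q.p (P.mesh (i.j + 1) / Q.L) := by
      unfold B2.pFn
      refine mul_nonneg hb0.le (Real.rpow_nonneg ?_ _)
      have : 0 ≤ Real.log (P.mesh (i.j + 1) / Q.L)⁻¹ := Real.log_nonneg ((one_le_inv₀ hx).2 hx1)
      linarith
    exact mul_nonneg (mul_nonneg hcl (Real.rpow_nonneg hx.le _)) hp
  exact h P hd hL' i hA hs hs1 hr _ φ ht0
    (B2Eq2108ErrorBound.printedThreshold_le hcl hb0.le (by linarith) hQL hs hs1) hφ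

/-! ## §4 (3.8) p. 584 for the carrier family -/

/-- **(3.8) p. 584 ON THE (Higgs)₂,₃ CARRIER** (*"we have applied formula (2.108) together with the remark following it …
According to the remark, the matrix elements h_k(x, x′) of the operator H_k satisfy the estimates |h_k(x, x′)| ≦
O(1)exp(−δ₁r(Lᵏε))exp(−δ₀|x − x′|), x, x′ ∈ Λ₆^{(k−1)′}. (3.8)"*): r02's typed `B2Sect3AStatements.Ineq38` — by its definition
the statement `Ineq2109` read at the chapter-3 step — holds for the family of all admissible carrier instances with fixed
`(d, L > 1, a > 0)` (unit-lattice kernel `(Lᵏε)²h_k`, torus distance of the `k`-sites, `r = r(Lᵏε)`), by the companion's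
`ineq2109_higgsLattice`.  (The §3 operator `H_k` of (3.7) is built by the same recipe from the chapter-3 sets; this is the
statement for the (2.108) recipe on abstract nested sets, which covers both.) [cite: Balaban1982Higgs2, (3.8) p.584, (2.109) p.580] -/
theorem ineq38_higgsLattice (d L : ℕ) (hL : 1 < L) {a : ℝ} (ha : 0 < a) :
    B2Sect3AStatements.Ineq38 (fun ι : AdmIdx d L a => ↥ι.i.L6 × Ix ι.N)
      (fun ι p q => ι.i.hkUnit a p q)
      (fun _ p q => (HiggsLattice.Site.tdist p.1.1 q.1.1 : ℝ)) (fun ι => ι.i.r) :=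
  ineq2109_higgsLattice d L hL ha

end Literature.MathematicalPhysics.QuantumFieldTheory.Balaban1983to89.B2Eq2108ErrorHiggsLattice

end
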